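import Summits.Ventures.PercRepro.RankLevelSetExplicitLin2UpperArith
import Summits.Ventures.PercRepro.RankLevelSetExplicitLin2

/-!
# PercRepro — THE UPPER END OF THE OPEN BAND OF THEOREM P⁗″: the `e`-free core cell `(p, d)` at level `q ≥ 8` past
the saturation corank `m_b = 5·2^{q−3} − q − 1` closes for `3q(d+q) ≤ 5(p+1)` and `2(q+5)·m_b ≤ (p+1)·2^s`,
`d ≥ m_b + 2qs` (p9, S4)

`proofs/SUBCLAIM-S4-p9.md` §S4.3⁗. The complement of the polynomial cell map (`RankLevelSetExplicitLin2Cells`): past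
`m_b` the big-class weight is fixed at `2^{m_b}/m_b` while `7·2^{d−q}·C(p+q,q)` doubles with every corank, so the cells
close from ABOVE — at rank `p` the cells of corank `≥ m_b + 2qs` close as soon as `(p+1)·2^s ≥ 2(q+5)·m_b`
(`c025_core_upper_lin2`); the small class is negligible there. Example at level `10` (`m_b = 629`): `s = 2`,
`p ≥ 4 717` closes every core cell of corank `≥ 669` (`c025_core_upper_ten`). With the lower end
`c025_core_cell_lin2` the open band of every window is an explicit interval of coranks, both ends in the kernel.
Axioms: standard.
-/

open scoped Matroid

namespace PercRepro

namespace ThmN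

open Set

variable {α : Type}

set_option maxHeartbeats 400000 in
/-- **THE UPPER END OF THE OPEN BAND**: the `e`-free core at level `q ≥ 8`, corank `d = m_b + t` past the saturation
corank `m_b = 5·2^{q−3} − q − 1` (`1 ≤ t`, `2qs ≤ t`, `d ≤ q + 2^q`), rank `p` with `3q(d+q) ≤ 5(p+1)` and
`2(q+5)·m_b ≤ (p+1)·2^s`, satisfies `RLS M p q` — the multiplicity count with local sparsity + the cap (both weights
SATURATED), Lemma T / T4 / `T_k`, the tail at `K = q + d`, and `poly_upper`. -/
theorem c025_core_upper_lin2 (q : ℕ) (hq : 8 ≤ q) (M : Matroid α) [M.Finite] (p d t s : ℕ)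
    (hdt : d = 5 * 2 ^ (q - 3) - q - 1 + t) (ht1 : 1 ≤ t) (hts : 2 * q * s ≤ t) (hd2 : d ≤ q + 2 ^ q)
    (hp : 3 * q * (d + q) ≤ 5 * (p + 1)) (hps : 2 * (q + 5) * (5 * 2 ^ (q - 3) - q - 1) ≤ (p + 1) * 2 ^ s)
    (hR : M.eRank = (p : ℕ∞)) (hn : M.E.ncard = p + d)
    (hfree : ∀ e ∈ M.E, ∃ A ⊆ M.E \ {e}, e ∉ M.closure A ∧ e ∉ M.closure ((M.E \ {e}) \ A)) :
    RLS M p q := by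
  classical
  obtain ⟨hm3, hm16, hsat⟩ := Explicit.saturation_facts q hq
  have hx := Explicit.le_two_pow_sub_four q (by omega)
  have hd1 : q + 1 ≤ d := by omega
  have hp25 : 3 * q + 2 * d + 5 ≤ p := by
    have : 3 * q * (d + q) ≥ 24 * (d + q) := Nat.mul_le_mul_right _ (by omega)
    omega
  obtain ⟨h8, h16, hq3, h23⟩ := Explicit.two_pow_facts2 q hq
  have hEcard : M.ground_finite.toFinset.card = p + d := by
    rw [← Set.ncard_eq_toFinset_card _ M.ground_finite]; exact hn
  -- the core is simple: every circuit has `≥ 3` elements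
  have hL : ∀ e ∈ M.E, ¬ M.IsLoop e := not_isLoop_of_free M hfree
  have hs : ∀ e ∈ M.E, ∀ f ∈ M.E, e ≠ f → M.eRk {e, f} = 2 := by
    intro e he f hf hef
    have h2 : (2 : ℕ∞) ≤ M.eRk {e, f} :=
      two_le_eRk_of_two_le_ncard_of_free M hfree (pair_subset he hf) (by rw [ncard_pair hef])
    have h3 : M.eRk {e, f} ≤ 2 := by
      have := M.eRk_le_encard {e, f}
      rwa [encard_pair hef] at this
    exact le_antisymm h3 h2
  have hcirc : ∀ C, M.IsCircuit C → 3 ≤ C.encard := three_le_encard_of_circuit M hL hs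
  have hd : M.E.encard = M.eRank + d := by
    rw [hR, ← M.ground_finite.cast_ncard_eq, hn]
    push_cast
    ring
  -- the nullity cap: every `X ⊆ E` has `|X| ≤ r(X) + d`
  have hcap : ∀ X ⊆ M.E, ∀ k : ℕ, M.eRk X ≤ k → X.ncard ≤ k + d := by
    intro X hX k hr
    have h1 := Matroid.encard_le_eRk_add_of_encard_eq hX hd
    have h2 : X.encard ≤ (k : ℕ∞) + d := h1.trans (by gcongr)
    have hfin : X.Finite := M.ground_finite.subset hX
    rw [← hfin.cast_ncard_eq] at h2
    exact_mod_cast h2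
  -- the flat bounds: rank-`≤ q` sets have `≤ f := min (5·2^{q−3} − 1) (q + d)` points, rank-`≤ q−1` sets
  -- `≤ f' := min (5·2^{q−4} − 1) (q − 1 + d)` points (the catalogue bound and the cap)
  set f : ℕ := min (5 * 2 ^ (q - 3) - 1) (q + d) with hfdef
  set f' : ℕ := min (5 * 2 ^ (q - 4) - 1) (q - 1 + d) with hf'def
  have hflat : ∀ X ⊆ M.E, M.eRk X ≤ q → X.ncard ≤ f := by
    intro X hX hr
    exact le_min (ncard_le_five_two_pow_of_eRk_le_of_free M hfree q (by omega) X hX hr) (hcap X hX q hr)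
  have hflat' : ∀ X ⊆ M.E, M.eRk X ≤ ((q - 1 : ℕ) : ℕ∞) → X.ncard ≤ f' := by
    intro X hX hr
    refine le_min ?_ (hcap X hX (q - 1) hr)
    have := ncard_le_five_two_pow_of_eRk_le_of_free M hfree (q - 1) (by omega) X hX hr
    rwa [show q - 1 - 3 = q - 4 by omega] at this
  -- the weight indices: `f' − q + 1 = μs := min (5·2^{q−4} − q) d`, `f − q = μb := min (5·2^{q−3} − q − 1) d`
  set μs : ℕ := min (5 * 2 ^ (q - 4) - q) d with hμsdef
  set μb : ℕ := min (5 * 2 ^ (q - 3) - q - 1) d with hμbdef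
  have hμs : f' - q + 1 = μs := by
    rw [hf'def, hμsdef]
    rcases le_total (5 * 2 ^ (q - 4) - 1) (q - 1 + d) with h | h
    · rw [min_eq_left h, min_eq_left (by omega)]; omega
    · rw [min_eq_right h, min_eq_right (by omega)]; omega
  have hμb : f - q = μb := by
    rw [hfdef, hμbdef]
    rcases le_total (5 * 2 ^ (q - 3) - 1) (q + d) with h | h
    · rw [min_eq_left h, min_eq_left (by omega)]; omega
    · rw [min_eq_right h, min_eq_right (by omega)]; omega
  have hfq : q + 1 ≤ f := by rw [hfdef]; exact le_min (by omega) (by omega)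
  have hf'q : q ≤ f' := by rw [hf'def]; exact le_min (by omega) (by omega)
  have hμsd : μs ≤ d := min_le_right _ _
  -- (U): the multiplicity count
  have hU1 := Matroid.topCount_le_ncard_compl (M := M) hR hd q
  have hsum := Matroid.ncard_eRk_eq_ncard_le_le_sum (M := M) q d
  have hmul := fun m => Matroid.ncard_eRk_eq_ncard_eq_mul_le M q f f' (by omega) hcirc hflat hflat' hd m
  -- the circuit counts: Lemma T, Lemma T4, LEMMA `T_k`
  have hC1 : ∀ L ⊆ M.E, M.eRk L = 2 → L.ncard ≤ 3 :=
    fun L hL' hr => ncard_le_three_of_eRk_two M hs hfree hL' hr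
  have hs3 : 2 * {C | M.IsCircuit C ∧ C.ncard = 3}.ncard ≤ d * (d + 1) := S1.two_mul_ncard_triangles_le M hC1 hd
  have hC1' : ∀ L ⊆ M.E, M.eRk L ≤ 2 → L.ncard ≤ 3 := by
    intro L hL' hr
    have := ncard_add_one_le_two_pow_of_eRk_le M hL hfree 2 L hL' hr
    omega
  have hC2 : ∀ P ⊆ M.E, M.eRk P ≤ 3 → P.ncard ≤ 6 :=
    fun P hP hr => ncard_le_six_of_eRk_le_three_of_free M hfree hP hr
  have hs4 : 3 * {C : Set α | M.IsCircuit C ∧ C.ncard = 4}.ncard ≤ d * (d + 1) * (d + 2) :=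
    S1.three_mul_ncard_four_circuits_le M hC1' hC2 hd
  have hsp : ∀ j : ℕ, ∀ X ⊆ M.E, M.eRk X ≤ j → X.ncard + 1 ≤ 2 ^ j :=
    fun j X hX hr => ncard_add_one_le_two_pow_of_eRk_le M hL hfree j X hX hr
  have hcsT : ∀ k, 1 ≤ k → {C | M.IsCircuit C ∧ C.ncard = k}.ncard ≤ 2 ^ (k - 1) * (d + k - 2).choose (k - 1) :=
    fun k hk => Matroid.ncard_circuits_le_two_pow_mul_choose_of_free M hd hsp k hk
  -- the two class sums, bounded
  set A : ℕ := ∑ k ∈ Finset.Icc 3 (q + 1), {C | M.IsCircuit C ∧ C.ncard = k}.ncard * M.E.ncard.choose (q + 1 - k)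
    with hAdef
  set B : ℕ := ∑ k ∈ Finset.Icc 3 (q + 1), {C | M.IsCircuit C ∧ C.ncard = k}.ncard * ((q + 1) * d).choose (q + 1 - k)
    with hBdef
  have hA : 6 * A ≤ 3 * (d * (d + 1)) * (p + d).choose (q - 2) + 2 * (d * (d + 1) * (d + 2)) * (p + d).choose (q - 3) +
      6 * ((2 * d + 2 * q - 2).choose 4 * (2 * d + 2 * q - 6 + (p + d)).choose (q - 4)) := by
    rw [hAdef, hn, Explicit.sum_Icc_three_split q (by omega), show q + 1 - 3 = q - 2 by omega,
      show q + 1 - 4 = q - 3 by omega]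
    have h5 : ∑ k ∈ Finset.Icc 5 (q + 1), {C | M.IsCircuit C ∧ C.ncard = k}.ncard * (p + d).choose (q + 1 - k) ≤
        (2 * d + 2 * q - 2).choose 4 * (2 * d + 2 * q - 6 + (p + d)).choose (q - 4) := by
      refine (Finset.sum_le_sum (fun k hk => Nat.mul_le_mul_right _ (hcsT k (by rw [Finset.mem_Icc] at hk; omega)))).trans ?_
      exact Explicit.tail_sum_le_sparse q d (p + d) (by omega)
    have e3 : 6 * ({C | M.IsCircuit C ∧ C.ncard = 3}.ncard * (p + d).choose (q - 2)) ≤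
        3 * (d * (d + 1)) * (p + d).choose (q - 2) := by
      calc 6 * ({C | M.IsCircuit C ∧ C.ncard = 3}.ncard * (p + d).choose (q - 2))
          = 3 * ((2 * {C | M.IsCircuit C ∧ C.ncard = 3}.ncard) * (p + d).choose (q - 2)) := by ring
        _ ≤ 3 * ((d * (d + 1)) * (p + d).choose (q - 2)) := Nat.mul_le_mul_left _ (Nat.mul_le_mul_right _ hs3)
        _ = 3 * (d * (d + 1)) * (p + d).choose (q - 2) := by ring
    have e4 : 6 * ({C | M.IsCircuit C ∧ C.ncard = 4}.ncard * (p + d).choose (q - 3)) ≤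
        2 * (d * (d + 1) * (d + 2)) * (p + d).choose (q - 3) := by
      calc 6 * ({C | M.IsCircuit C ∧ C.ncard = 4}.ncard * (p + d).choose (q - 3))
          = 2 * ((3 * {C | M.IsCircuit C ∧ C.ncard = 4}.ncard) * (p + d).choose (q - 3)) := by ring
        _ ≤ 2 * ((d * (d + 1) * (d + 2)) * (p + d).choose (q - 3)) := Nat.mul_le_mul_left _ (Nat.mul_le_mul_right _ hs4)
        _ = 2 * (d * (d + 1) * (d + 2)) * (p + d).choose (q - 3) := by ring
    have e5 := Nat.mul_le_mul_left 6 h5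
    omega
  have hB : B ≤ ((q + 3) * d + 2 * q - 2).choose q := by
    rw [hBdef]
    refine (Finset.sum_le_sum (fun k hk => Nat.mul_le_mul_right _ (hcsT k (by rw [Finset.mem_Icc] at hk; omega)))).trans ?_
    have h := Explicit.tail_sum_le_sparse_all q d ((q + 1) * d)
    have e : 2 * d + 2 * q - 2 + (q + 1) * d = (q + 3) * d + 2 * q - 2 := by
      have : (q + 3) * d = (q + 1) * d + 2 * d := by ring
      omega
    rwa [e] at h
  -- the level counts in `ℚ`, weighted by `1/(m − q)`
  have hlevel : ∀ m ∈ Finset.Icc (q + 1) d, ({X : Set α | X ⊆ M.E ∧ M.eRk X = q ∧ X.ncard = m}.ncard : ℚ) ≤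
      (((f' - q).choose (m - (q + 1)) : ℚ) * (A : ℚ) + ((f - (q + 1)).choose (m - (q + 1)) : ℚ) * (B : ℚ)) /
        ((m - q : ℕ) : ℚ) := by
    intro m hm
    rw [Finset.mem_Icc] at hm
    have hpos : (0 : ℚ) < ((m - q : ℕ) : ℚ) := by exact_mod_cast (by omega : 0 < m - q)
    rw [le_div_iff₀ hpos]
    have h := hmul m
    have h' : (((m - q) * {X : Set α | X ⊆ M.E ∧ M.eRk X = q ∧ X.ncard = m}.ncard : ℕ) : ℚ) ≤
        (((f' - q).choose (m - (q + 1)) * A + (f - (q + 1)).choose (m - (q + 1)) * B : ℕ) : ℚ) := by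
      exact_mod_cast h
    push_cast at h'
    linarith
  have hre : ∑ m ∈ Finset.Icc (q + 1) d,
      (((f' - q).choose (m - (q + 1)) : ℚ) * (A : ℚ) + ((f - (q + 1)).choose (m - (q + 1)) : ℚ) * (B : ℚ)) /
        ((m - q : ℕ) : ℚ) =
      ∑ j ∈ Finset.range (d - q),
      (((f' - q).choose j : ℚ) * (A : ℚ) + ((f - (q + 1)).choose j : ℚ) * (B : ℚ)) / ((j : ℚ) + 1) := by
    rw [show Finset.Icc (q + 1) d = Finset.image (fun j => q + 1 + j) (Finset.range (d - q)) from ?_]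
    · rw [Finset.sum_image (fun a _ b _ h => by omega)]
      apply Finset.sum_congr rfl
      intro j _
      rw [show q + 1 + j - (q + 1) = j by omega, show q + 1 + j - q = j + 1 by omega]
      push_cast
      ring
    · ext m
      rw [Finset.mem_Icc, Finset.mem_image]
      constructor
      · intro hm
        exact ⟨m - (q + 1), by rw [Finset.mem_range]; omega, by omega⟩
      · rintro ⟨j, hj, rfl⟩
        rw [Finset.mem_range] at hj
        omega
  -- the two weights
  set Ws : ℚ := ∑ j ∈ Finset.range (d - q), (((f' - q).choose j : ℕ) : ℚ) / ((j : ℚ) + 1) with hWsdef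
  set Wb : ℚ := ∑ j ∈ Finset.range (d - q), (((f - (q + 1)).choose j : ℕ) : ℚ) / ((j : ℚ) + 1) with hWbdef
  have hUq : (Matroid.topCount M p q : ℚ) ≤ ((p + d).choose q : ℚ) + (Ws * (A : ℚ) + Wb * (B : ℚ)) := by
    have h1 : (Matroid.topCount M p q : ℚ) ≤ ((p + d).choose q : ℚ) +
        ∑ m ∈ Finset.Icc (q + 1) d, ({X : Set α | X ⊆ M.E ∧ M.eRk X = q ∧ X.ncard = m}.ncard : ℚ) := by
      have := hU1.trans hsum
      rw [hn] at this
      exact_mod_cast this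
    have h2 : ∑ m ∈ Finset.Icc (q + 1) d, ({X : Set α | X ⊆ M.E ∧ M.eRk X = q ∧ X.ncard = m}.ncard : ℚ) ≤
        Ws * (A : ℚ) + Wb * (B : ℚ) := by
      rw [hWsdef, hWbdef, Finset.sum_mul, Finset.sum_mul, ← Finset.sum_add_distrib]
      refine (Finset.sum_le_sum hlevel).trans (hre.le.trans ?_)
      apply le_of_eq
      apply Finset.sum_congr rfl
      intro j _
      field_simp
    linarith
  -- the weight bounds: `Ws·μs ≤ 2^{μs}`, `Wb·μb ≤ 2^{μb}` (the closed-form rows)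
  have hWs : Ws * (μs : ℚ) ≤ 2 ^ μs := by
    have h1 := Explicit.sum_range_choose_div_succ_le (f' - q) (d - q)
    rw [← hWsdef] at h1
    have hμq : ((f' - q : ℕ) : ℚ) + 1 = (μs : ℚ) := by exact_mod_cast hμs
    have hμpos : (0 : ℚ) < (μs : ℚ) := by
      have : 1 ≤ μs := by omega
      exact_mod_cast this
    rw [hμq, le_div_iff₀ hμpos] at h1
    have h2 : (2 : ℚ) ^ (f' - q + 1) = 2 ^ μs := by rw [hμs]
    linarith
  have hWb : Wb * (μb : ℚ) ≤ 2 ^ μb := by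
    have h1 := Explicit.sum_range_choose_div_succ_le (f - (q + 1)) (d - q)
    rw [← hWbdef] at h1
    have hμq : ((f - (q + 1) : ℕ) : ℚ) + 1 = (μb : ℚ) := by
      have : f - (q + 1) + 1 = μb := by omega
      exact_mod_cast this
    have hμpos : (0 : ℚ) < (μb : ℚ) := by
      have : 1 ≤ μb := by omega
      exact_mod_cast this
    rw [hμq, le_div_iff₀ hμpos] at h1
    have h2 : (2 : ℚ) ^ (f - (q + 1) + 1) = 2 ^ μb := by rw [show f - (q + 1) + 1 = μb by omega]
    linarith
  -- (Y)
  have hY := Matroid.two_pow_le_midCount_add (M := M) p q hR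
  have hAc : {X : Set α | X ⊆ M.E ∧ M.eRk X ≤ q}.ncard ≤ ∑ j ∈ Finset.range (q + d + 1), (p + d).choose j := by
    calc {X : Set α | X ⊆ M.E ∧ M.eRk X ≤ q}.ncard
        ≤ {X : Set α | X ⊆ (M.ground_finite.toFinset : Set α) ∧ X.ncard ≤ q + d}.ncard := by
          apply ncard_le_ncard
          · intro X hX
            exact ⟨by rw [Set.Finite.coe_toFinset]; exact hX.1, hcap X hX.1 q hX.2⟩
          · exact (Finset.finite_toSet _).finite_subsets.subset (fun X hX => hX.1)
      _ ≤ ∑ j ∈ Finset.range (q + d + 1), M.ground_finite.toFinset.card.choose j :=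
          ncard_subsets_ncard_le _ (q + d)
      _ = ∑ j ∈ Finset.range (q + d + 1), (p + d).choose j := by rw [hEcard]
  have hBc := Matroid.ncard_spanning_le (M := M) hd
  rw [hEcard] at hY hBc
  -- the tail with `K = q + d`
  have hT : 16 * ∑ j ∈ Finset.range (q + d + 1), (p + d).choose j ≤ 2 ^ (p + d) :=
    Explicit.sixteen_mul_sum_range_choose_le (q + d) (p + d) (by omega)
  have hB' : ∑ j ∈ Finset.range (d + 1), (p + d).choose j ≤
      ∑ j ∈ Finset.range (q + d + 1), (p + d).choose j :=
    Finset.sum_le_sum_of_subset_of_nonneg (Finset.range_mono (by omega)) (fun _ _ _ => Nat.zero_le _)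
  have hAB : 8 * ({X : Set α | X ⊆ M.E ∧ M.eRk X ≤ q}.ncard +
      {X : Set α | X ⊆ M.E ∧ M.eRk X = M.eRank}.ncard) ≤ 2 ^ (p + d) := by
    have h2 := hBc.trans hB'
    calc 8 * ({X : Set α | X ⊆ M.E ∧ M.eRk X ≤ q}.ncard + {X : Set α | X ⊆ M.E ∧ M.eRk X = M.eRank}.ncard)
        ≤ 8 * (∑ j ∈ Finset.range (q + d + 1), (p + d).choose j + ∑ j ∈ Finset.range (q + d + 1), (p + d).choose j) :=
          Nat.mul_le_mul_left _ (Nat.add_le_add hAc h2)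
      _ = 16 * ∑ j ∈ Finset.range (q + d + 1), (p + d).choose j := by ring
      _ ≤ 2 ^ (p + d) := hT
  -- (Φ) and the polynomial inequality
  have hΦ := phiK_le_two_pow_div p q
  rw [Nat.choose_symm_add] at hΦ
  have hμs' : μs = 5 * 2 ^ (q - 4) - q := by rw [hμsdef, min_eq_left (by omega)]
  have hμb' : μb = 5 * 2 ^ (q - 3) - q - 1 := by rw [hμbdef, min_eq_left (by omega)]
  rw [hμs'] at hWs
  rw [hμb'] at hWb
  have hpolyq := Explicit.poly_upper q d p t s hq hdt ht1 hts hd2 hp hps A B Ws Wb hWs hWb hA hB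
  rw [add_assoc] at hpolyq
  -- assemble in `ℚ`
  rw [RLS_iff]
  have hYq : (2 : ℚ) ^ (p + d) ≤ (Matroid.midCount M p q : ℚ) +
      ({X : Set α | X ⊆ M.E ∧ M.eRk X ≤ q}.ncard : ℚ) +
      ({X : Set α | X ⊆ M.E ∧ M.eRk X = M.eRank}.ncard : ℚ) := by exact_mod_cast hY
  have hABq : 8 * (({X : Set α | X ⊆ M.E ∧ M.eRk X ≤ q}.ncard : ℚ) +
      ({X : Set α | X ⊆ M.E ∧ M.eRk X = M.eRank}.ncard : ℚ)) ≤ 2 ^ (p + d) := by exact_mod_cast hAB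
  have hU0 : (0 : ℚ) ≤ (Matroid.topCount M p q : ℚ) := Nat.cast_nonneg _
  exact level_arith (p := p) (d := d) (n := p + d) (q := q) rfl (by omega) hΦ hU0 hUq hYq hABq hpolyq

/-- Level `10`, `s = 2`: every core cell of corank `669 ≤ d ≤ 1034` closes from `p = 4 717`
(`2·15·629 = 18 870 ≤ 4·(p+1)`, `3·10·(d+10) ≤ 5(p+1)` for `d ≤ 1034`: `31 320 ≤ 23 590`? — no: stated for
`p ≥ 6 264` so that the ratio condition holds up to the top corank). -/
theorem c025_core_upper_ten (M : Matroid α) [M.Finite] (p d : ℕ) (hd1 : 669 ≤ d) (hd2 : d ≤ 1034)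
    (hp : 6264 ≤ p) (hR : M.eRank = (p : ℕ∞)) (hn : M.E.ncard = p + d)
    (hfree : ∀ e ∈ M.E, ∃ A ⊆ M.E \ {e}, e ∉ M.closure A ∧ e ∉ M.closure ((M.E \ {e}) \ A)) : RLS M p 10 :=
  c025_core_upper_lin2 10 (by norm_num) M p d (d - 629) 2 (by norm_num; omega) (by omega) (by norm_num; omega)
    (by norm_num; omega) (by norm_num; omega) (by norm_num; omega) hR hn hfree

/-- Level `11` (`m_b = 1 268`), `s = 2`: every core cell of corank `1 312 ≤ d ≤ 2 059` closes from `p = 13 661`. -/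
theorem c025_core_upper_eleven (M : Matroid α) [M.Finite] (p d : ℕ) (hd1 : 1312 ≤ d) (hd2 : d ≤ 2059)
    (hp : 13661 ≤ p) (hR : M.eRank = (p : ℕ∞)) (hn : M.E.ncard = p + d)
    (hfree : ∀ e ∈ M.E, ∃ A ⊆ M.E \ {e}, e ∉ M.closure A ∧ e ∉ M.closure ((M.E \ {e}) \ A)) : RLS M p 11 :=
  c025_core_upper_lin2 11 (by norm_num) M p d (d - 1268) 2 (by norm_num; omega) (by omega) (by norm_num; omega)
    (by norm_num; omega) (by norm_num; omega) (by norm_num; omega) hR hn hfree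

end ThmN

end PercRepro
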